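import Literature.Analysis.ValidatedNumerics.TaylorModelZeroCert
import Mathlib.Analysis.SumIntegralComparisons
import Mathlib.Analysis.SpecificLimits.Normed
import Mathlib.Analysis.Normed.Group.InfiniteSum
import HarnessLib

/-!
# Kernel-checked enclosures of infinite series: heads by exact or interval summation, tails by certified
# geometric majorants, the Leibniz bracket and the integral test

Trunk T-ANA (Analysis/ValidatedNumerics); namespace `Literature.Analysis.ValidatedNumerics.PolyMP`.
Sequel of `TaylorModelZeroCert.lean` (the POINT model `M.pointI` of a program `p : GProg M` of a statement family
`M : OpModel`, `F : OpSem M`: `P(ps; x)·S ∈ [Y̲, Ȳ]`, `mem_pointI`) and of `TaylorModelIntegralCertFamily.lean` (the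
PANEL model `M.pmodelP` of `u ↦ P(ps; c + u)` on `|u| ≤ h`, uniformly over a parameter box, `tmem_pmodelP`; the
range bounds `tupperI` / `tlowerI` / `tabsI` of `TaylorModel.lean`).  THE PROBLEM (Johansson, Sect. 4): to enclose
the value of a convergent series `∑ₙ aₙ` one computes a truncated sum `S(N) = ∑_{n<N} aₙ` in interval arithmetic and
bounds the tail `∑_{n≥N} aₙ` rigorously from the size of the first omitted term `a_N` and a CERTIFIED MAJORANT of the
term ratios `|aₙ₊₁/aₙ| ≤ q < 1` for all `n ≥ N` (op. cit. Thm. 1: `|∑_{n≥N} aₙ| ≤ |a_N|/(1 − q)`), sharpened to the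
one-sided Leibniz bracket when the terms alternate and to `[a_N, a_N/(1 − q)]` when they keep their sign; for slowly
convergent monotone series the integral test brackets the tail instead.  Nothing of the kind existed in this
directory (finite sums only: `ExpSumEnclosure`; one private geometric tail inside `MultiPrecisionInterval.MI.pi`);
this module supplies it, in three layers:

* Part A — TAILS OVER `ℝ` (no kernels; any `a : ℕ → ℝ`): `summable_of_abs_succ_le` and `abs_tsum_shift_le`
  (an eventual ratio majorant `|aₙ₊₁| ≤ q|aₙ|`, `n ≥ N`, `0 ≤ q < 1`, gives summability and
  `|∑' k, a (k + N)| ≤ |a N|/(1 − q)`), the two-sided enclosure `tsum_bounds_of_abs_succ_le`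
  (`∑' n, a n ∈ S(N) ± A/(1 − q)` for any `A ≥ |a N|`) and its constant-sign sharpening
  `tsum_bounds_of_abs_succ_le_of_nonneg` (`∑' ∈ S(N) + [a N, a N/(1 − q)]`); the LEIBNIZ BRACKET
  `tsum_shift_mem_of_alternating` / `tsum_bounds_of_alternating` (summable, `aₙ aₙ₊₁ ≤ 0` and `|aₙ₊₁| ≤ |aₙ|` from
  `N` on: the tail lies between `0` and `a N`, i.e. `∑' ∈ S(N) + [min(a N, 0), max(a N, 0)]` — proved by pairing
  consecutive terms, for the UNCONDITIONAL `tsum` of Mathlib, so absolute summability is a hypothesis, which the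
  geometric majorant supplies); and the INTEGRAL-TEST BRACKET `tsum_bounds_of_antitoneOn` (`f ≥ 0` antitone and
  integrable on `[N, ∞)`: `S(N) + ∫_N^∞ f ≤ ∑' n, f n ≤ S(N + 1) + ∫_N^∞ f`, width `f(N)`; the two one-sided
  comparisons are Mathlib's `AntitoneOn.tsum_comp_add_le_integral` / `AntitoneOn.integral_le_tsum_comp_add`).
* Part B — EXACT-RATIONAL KERNELS (no statement family; everything decided over `ℚ`): the eventual sign of a
  polynomial, `nonnegFrom P x₀` / `posFrom P x₀` (all Taylor coefficients of `P(x₀ + u)` are `≥ 0`, the constant one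
  `> 0`: Descartes' bound, zero sign variations — `P ≥ 0`, resp. `> 0`, on `[x₀, ∞)`); HYPERGEOMETRIC TERMS
  `hypAcc a₀ num den n = (tₙ, ∑_{i<n} tᵢ)` of the first-order recurrence `tₙ₊₁ · den(n) = tₙ · num(n)`, `t₀ = a₀`
  (`num`, `den : Poly` over `ℚ`), with `eq_hypTerm` (a real sequence obeying the recurrence with non-vanishing `den`
  IS `(tₙ)`); the RATIO CERTIFICATE `hypRatioCheck num den N qn qd` (`0 ≤ qn < qd`, `den ≠ 0` below `N`, and from
  `N` on `den > 0` and `qd·|num| ≤ qn·den`, as three eventual-sign certificates) with the modes `SMode.geom | alt |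
  pos` of `hypCheck` (alternation = `num < 0` from `N` on; constant sign = `num > 0` from `N` on and `t_N ≥ 0`) and
  the exact bounds `hypBounds`; and OUTWARD-ROUNDED PARTIAL SUMS `qsumI S t n₀ n ∋ (∑_{i<n} t(n₀ + i))·S` of any
  computable rational sequence (`mem_qsumI`), for long heads of slowly convergent series.
* Part B′ — STATEMENT-FAMILY KERNELS (any `M : OpModel`, `F : OpSem M`, uniformly over a parameter box `B`): the
  HEAD SUM BY POINT MODELS `M.headSumI prm S p B idx css n₀ n` (`(∑_{i<n} P(ps; idx(n₀ + i)))·S ∈` the folded point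
  enclosures; `mem_headSumI`); the RATIO CERTIFICATE ON A BOX `M.ratioCheck prm S pN pD B u₀ h csN csD qn qd` (panel
  models of two programs `Num`, `Den` on `|u − u₀| ≤ h`: `Den(ps; u) > 0` and `qd·|Num(ps; u)| ≤ qn·Den(ps; u)` read
  off `tlowerI` / `tabsI`; `pos_and_ratio_le_of_ratioCheck`), and the sign certificates `M.negOnCheck` /
  `M.posOnCheck` of a program on a box (`neg_of_negOnCheck`, `pos_of_posOnCheck`).  The client supplies an INDEX MAP
  `g : ℕ → ℝ` into the box (typically `g n = 1/n`, the compactification of `n → ∞`) and the identification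
  `|aₙ₊₁|·Den(ps; g n) ≤ |aₙ|·|Num(ps; g n)|` (or the equation `aₙ₊₁·Den = aₙ·Num`), discharged by `simp` / `ring`
  for concrete series.
* Part C — THE ASSEMBLED ENCLOSURES: `hyp_tsum_bounds` (ONE `decide` of `hypCheck` plus the two identification
  hypotheses `a 0 = a₀`, `aₙ₊₁·den(n) = aₙ·num(n)` give `Summable a` and `lo ≤ ∑' n, a n ≤ hi` with the exact
  rational `(lo, hi) = hypBounds …` of the chosen mode); `tsum_bounds_of_ratioCheck` (box ratio certificate + head
  enclosure `Hd ∋ S(N)·S` from `headSumI` / `qsumI` / exact + `|a N| ≤ A`: `∑' ∈ [Hd.lo/S − A·qd/(qd − qn),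
  Hd.hi/S + A·qd/(qd − qn)]`) and its Leibniz sharpening `tsum_bounds_of_ratioCheck_alt`.

Worked end to end (scratch kept OUT of the tree, `Certquad.ScratchSeries`, one file on top of this module; 17 s on
the farm including every kernel call).  By the EXACT path — ONE `decide` of `hypCheck` per series, two identification
lemmas (`a 0 = a₀` and `aₙ₊₁·den(n) = aₙ·num(n)`, by `push_cast; ring`, resp. `linear_combination` against
`Nat.succ_mul_centralBinom_succ`) and one more `decide` comparing the exact rational bounds with decimals: the
alternating central-binomial series `∑_{n≥0} (−1)ⁿ/((n+1)³·C(2n+2, n+1))` of Apéry type (`N = 50`, `q = 1/4`,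
mode `alt`) to width `1.9·10⁻³⁵`; `∑_{n≥1} 1/(2ⁿn⁴)` (`= Li₄(1/2)`; `N = 110`, `q = 1/2`, `pos`) to `3·10⁻⁴²`;
`log 2 = ∑ (1/2)ⁿ⁺¹/(n+1)` (through Mathlib's `Real.hasSum_pow_div_log_of_abs_lt_one`; `pos`) to `5·10⁻³⁶`
(Mathlib's own `Real.log_two_gt_d9` has 9 digits); `π` by Machin's two arctangent series (`alt`, `N = 38` and
`12`, through `Real.hasSum_arctan` and `Real.four_mul_arctan_inv_5_sub_arctan_inv_239`) to `3.2·10⁻⁵⁵`.  By the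
INTEGRAL TEST: `ζ(3) = ∑ 1/n³` summed slowly — a `qsumI` head of 2000 terms at scale `2⁶⁴` and
`∫_{2000}^∞ t⁻³ dt = 1/(8·10⁶)` (Mathlib's `integral_Ioi_rpow_of_lt`, `integrableOn_Ioi_rpow_of_lt`) give width
`1.4·10⁻¹⁰`.  By the GENERAL path through the `slp` family: the theta-type sum `∑_{n≥0} e^{−n²}` to `6·10⁻³⁴` —
nine point models of `e^{−t} = ((e^{−t/4})²)²` at `t = n²` (`headSumI`, `S = 2¹²⁰`), the ratio box
`Num(u) = u ∋ e^{−(2n+1)}`, `n ≥ 9`, `Den = 1` (`ratioCheck`, `q = 1.2·10⁻⁸`), and `|a₉| = e^{−81} ≤ 10⁻³⁵` from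
`Real.exp_one_gt_d9`.  Usage note: keep the kernel-evaluated ground terms (values of `qsumI` / `headSumI`, partial
sums over `Finset.range 2000`) out of `linarith` and `exact … .trans …` — `generalize` them first, or the
elaborator tries to unfold them.

Honest framing.  These are shared numerical engines serving client cells; rigour lives in the verifiers (the
soundness theorems below, whose hypotheses are Boolean certificates decided by the kernel and identification
hypotheses about the client's own series); every published number belongs to a client cell's ledger, not to this
module.  ANCHOR / nearest in-tree relatives: `TaylorModelZeroCert` (USED: `pointI`, `mem_pointI`),
`TaylorModelIntegralCertFamily` (USED: `pmodelP`, `tmem_pmodelP`), `TaylorModel` (USED: `tupperI`, `tlowerI`,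
`tabsI` and their soundness), `TaylorModelIntegralCert` (USED: `recenterAt`, the exact Taylor shift of a `Poly`),
`IntervalPolynomial` (USED: `ofRat`, `mem_ofRat`), `MultiPrecisionInterval` (USED: `MI.add`, `MI.mem_add`; its
`MI.pi` sums Machin's series with a private tail bound — the worked example re-derives an enclosure of `π` through
the public theorems here as a cross-check, not a replacement), `ExpSumEnclosure` (finite exponential sums; not
bridged), Mathlib's `SumIntegralComparisons` (USED: the integral test) and `alternating_series_error_bound` (the
symmetric form `|tail| ≤ f n` for series literally of the shape `∑ (−1)ⁱ fᵢ`; the bracket here is one-sided and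
stated for any real sequence alternating from `N` on).  Deliberately NOT here: Euler–Maclaurin and convexity
(Hermite–Hadamard) sharpenings of the integral-test bracket (they need sign-regular higher derivatives on `[N, ∞)`),
slowly convergent ALTERNATING series (`q < 1` fails; the Leibniz bracket alone would need summability from elsewhere
and gives few digits), conditionally convergent series (their `tsum` is `0` by convention in Mathlib — every
statement here is about absolutely summable series), sequence transformations / convergence acceleration (untrusted
proposers may use them; the kernel certifies only what is stated here), complex terms, and any floating-point
arithmetic (all certificate data are exact rationals and scaled integers).  Problem-independent; no facts, no axioms;
all certificate data computable over `ℚ` and `ℤ`.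

References: [cite: Johansson2019, Sect. 4.1 Thm. 1]; [cite: Johansson2019, Sect. 4]; [cite: Johansson2019, Sect. 2];
[cite: BreuerZwas1993, Sect. 6.2 (6.9)–(6.10)]; [cite: BreuerZwas1993, Sect. 6.6 (6.35)]; [cite: Jameson2003, Prop. 1.4.4];
[cite: BasuPollackRoy2006, Sect. 2.2.1 Thm. 2.33]; [cite: MakinoBerz2003, Algorithm 2];
[cite: MahboubiMelquiondSibutpinote2016, Sect. 4.1]; [cite: Moore1979, Sect. 2.2 (2.16)–(2.21)].

AI-produced formalisation (H21 engines group, seat eng-quad-3 gen 59, 2026-08-23); no facts, no axioms, no `sorry`.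
-/

open Set Filter

namespace Literature.Analysis.ValidatedNumerics

namespace PolyMP

open Literature.Analysis.ValidatedNumerics.NumericsMP
open Literature.Analysis.ValidatedNumerics.ExpPoly (Poly BPoly)
open Literature.Analysis.ValidatedNumerics.ExpPoly

/-! ### Part A. Tails of real series: geometric majorants, the Leibniz bracket, the integral test -/

section Tails

variable {a : ℕ → ℝ} {q : ℝ} {N : ℕ}

/-- The ratio majorant iterated: `|a (k + N)| ≤ |a N|·qᵏ`. [cite: Johansson2019, Sect. 4.1 Thm. 1] -/
theorem abs_shift_le_mul_pow (hq : 0 ≤ q) (h : ∀ n, N ≤ n → |a (n + 1)| ≤ q * |a n|) :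
    ∀ k : ℕ, |a (k + N)| ≤ |a N| * q ^ k
  | 0 => by simp
  | k + 1 => by
      have h1 : |a (k + N + 1)| ≤ q * |a (k + N)| := h (k + N) (Nat.le_add_left N k)
      have e : k + 1 + N = k + N + 1 := by omega
      rw [e]
      calc |a (k + N + 1)| ≤ q * |a (k + N)| := h1
        _ ≤ q * (|a N| * q ^ k) := mul_le_mul_of_nonneg_left (abs_shift_le_mul_pow hq h k) hq
        _ = |a N| * q ^ (k + 1) := by ring

/-- **d'Alembert with an eventual geometric majorant**: `|aₙ₊₁| ≤ q|aₙ|` for `n ≥ N` with `q < 1` gives (absolute)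
summability. [cite: Johansson2019, Sect. 4.1 Thm. 1] -/
theorem summable_of_abs_succ_le (hq1 : q < 1) (h : ∀ n, N ≤ n → |a (n + 1)| ≤ q * |a n|) : Summable a :=
  summable_of_ratio_norm_eventually_le hq1
    (eventually_atTop.2 ⟨N, fun n hn => by simpa only [Real.norm_eq_abs] using h n hn⟩)

/-- **The geometric tail bound**: `|∑_{n ≥ N} aₙ| ≤ |a_N|/(1 − q)`.
[cite: Johansson2019, Sect. 4.1 Thm. 1] [cite: BreuerZwas1993, Sect. 6.6 (6.35)] -/
theorem abs_tsum_shift_le (hq0 : 0 ≤ q) (hq1 : q < 1) (h : ∀ n, N ≤ n → |a (n + 1)| ≤ q * |a n|) :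
    |∑' k, a (k + N)| ≤ |a N| / (1 - q) := by
  have hs : Summable a := summable_of_abs_succ_le hq1 h
  have hsN : Summable fun k => a (k + N) := (summable_nat_add_iff N).2 hs
  have habs : Summable fun k => |a (k + N)| := hsN.abs
  have hg : Summable fun k => |a N| * q ^ k := (summable_geometric_of_lt_one hq0 hq1).mul_left _
  have h1 : |∑' k, a (k + N)| ≤ ∑' k, |a (k + N)| := by
    have habs' : Summable fun k => ‖a (k + N)‖ := by simpa only [Real.norm_eq_abs] using habs
    have := norm_tsum_le_tsum_norm habs'
    simpa only [Real.norm_eq_abs] using this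
  have h2 : ∑' k, |a (k + N)| ≤ ∑' k, |a N| * q ^ k :=
    habs.tsum_le_tsum (abs_shift_le_mul_pow hq0 h) hg
  have h3 : ∑' k : ℕ, |a N| * q ^ k = |a N| / (1 - q) := by
    rw [tsum_mul_left, tsum_geometric_of_lt_one hq0 hq1, div_eq_mul_inv]
  exact h1.trans (h2.trans h3.le)

/-- **The two-sided series enclosure from a ratio majorant**: with the truncated sum `S(N) = ∑_{i<N} aᵢ` and any
`A ≥ |a_N|`, `S(N) − A/(1 − q) ≤ ∑' n, a n ≤ S(N) + A/(1 − q)`. [cite: Johansson2019, Sect. 4.1 Thm. 1] -/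
theorem tsum_bounds_of_abs_succ_le (hq0 : 0 ≤ q) (hq1 : q < 1)
    (h : ∀ n, N ≤ n → |a (n + 1)| ≤ q * |a n|) {A : ℝ} (hA : |a N| ≤ A) :
    Summable a ∧ (∑ i ∈ Finset.range N, a i) - A / (1 - q) ≤ ∑' n, a n ∧
      ∑' n, a n ≤ (∑ i ∈ Finset.range N, a i) + A / (1 - q) := by
  have hs := summable_of_abs_succ_le hq1 h
  have ht := abs_tsum_shift_le hq0 hq1 h
  have hsplit : ∑' n, a n = (∑ i ∈ Finset.range N, a i) + ∑' k, a (k + N) :=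
    (hs.sum_add_tsum_nat_add N).symm
  have hA' : |a N| / (1 - q) ≤ A / (1 - q) := div_le_div_of_nonneg_right hA (by linarith)
  rw [abs_le] at ht
  refine ⟨hs, ?_, ?_⟩ <;> rw [hsplit] <;> linarith [ht.1, ht.2]

/-- **The constant-sign sharpening**: if moreover `aₙ ≥ 0` for `n ≥ N`, then
`S(N) + a_N ≤ ∑' n, a n ≤ S(N) + a_N/(1 − q)`. [cite: Johansson2019, Sect. 4.1 Thm. 1] -/
theorem tsum_bounds_of_abs_succ_le_of_nonneg (hq0 : 0 ≤ q) (hq1 : q < 1)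
    (h : ∀ n, N ≤ n → |a (n + 1)| ≤ q * |a n|) (hpos : ∀ n, N ≤ n → 0 ≤ a n) :
    Summable a ∧ (∑ i ∈ Finset.range N, a i) + a N ≤ ∑' n, a n ∧
      ∑' n, a n ≤ (∑ i ∈ Finset.range N, a i) + a N / (1 - q) := by
  have hs := summable_of_abs_succ_le hq1 h
  have hsN : Summable fun k => a (k + N) := (summable_nat_add_iff N).2 hs
  have ht := abs_tsum_shift_le hq0 hq1 h
  rw [abs_of_nonneg (hpos N le_rfl)] at ht
  have hlow : a N ≤ ∑' k, a (k + N) := by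
    have := hsN.sum_le_tsum (Finset.range 1) (fun k _ => hpos (k + N) (Nat.le_add_left N k))
    simpa using this
  have hsplit : ∑' n, a n = (∑ i ∈ Finset.range N, a i) + ∑' k, a (k + N) :=
    (hs.sum_add_tsum_nat_add N).symm
  refine ⟨hs, ?_, ?_⟩ <;> rw [hsplit] <;> linarith [(abs_le.1 ht).2]

/-- One step of the Leibniz sign pattern: a non-negative term is followed by a non-positive one. [folklore] -/
private theorem nonpos_succ_of_nonneg {c : ℕ → ℝ} {i : ℕ} (hc : 0 ≤ c i) (halt : c i * c (i + 1) ≤ 0)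
    (hmono : |c (i + 1)| ≤ |c i|) : c (i + 1) ≤ 0 := by
  rcases hc.lt_or_eq with hlt | heq
  · rcases le_or_gt (c (i + 1)) 0 with hle | hcon
    · exact hle
    · nlinarith [mul_pos hlt hcon]
  · rw [← heq, abs_zero] at hmono
    exact (abs_nonpos_iff.1 hmono).le

/-- The mirror step: a non-positive term is followed by a non-negative one. [folklore] -/
private theorem nonneg_succ_of_nonpos {c : ℕ → ℝ} {i : ℕ} (hc : c i ≤ 0) (halt : c i * c (i + 1) ≤ 0)
    (hmono : |c (i + 1)| ≤ |c i|) : 0 ≤ c (i + 1) := by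
  have h := nonpos_succ_of_nonneg (c := fun n => -c n) (i := i) (by simpa using hc)
    (by simpa using halt) (by simpa only [abs_neg] using hmono)
  simpa using h

/-- The Leibniz pairing: the even-indexed terms are `≥ 0` and each pair `c (2k) + c (2k + 1)` is `≥ 0`.
[folklore] -/
private theorem leibniz_pairs {c : ℕ → ℝ} (halt : ∀ i, c i * c (i + 1) ≤ 0)
    (hmono : ∀ i, |c (i + 1)| ≤ |c i|) (h0 : 0 ≤ c 0) :
    ∀ k : ℕ, 0 ≤ c (2 * k) ∧ 0 ≤ c (2 * k) + c (2 * k + 1)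
  | 0 => by
      have h1 : |c (0 + 1)| ≤ |c 0| := hmono 0
      rw [abs_of_nonneg h0] at h1
      have e : 2 * 0 = 0 := rfl
      rw [e]
      exact ⟨h0, by linarith [neg_abs_le (c (0 + 1))]⟩
  | k + 1 => by
      obtain ⟨hk, -⟩ := leibniz_pairs halt hmono h0 k
      have h1 : c (2 * k + 1) ≤ 0 := nonpos_succ_of_nonneg hk (halt _) (hmono _)
      have h2 : 0 ≤ c (2 * k + 1 + 1) := nonneg_succ_of_nonpos h1 (halt _) (hmono _)
      have h3 : |c (2 * k + 1 + 1 + 1)| ≤ |c (2 * k + 1 + 1)| := hmono _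
      rw [abs_of_nonneg h2] at h3
      have e : 2 * (k + 1) = 2 * k + 1 + 1 := by ring
      rw [e]
      exact ⟨h2, by linarith [neg_abs_le (c (2 * k + 1 + 1 + 1))]⟩

/-- The sum of a summable Leibniz sequence starting with a non-negative term is `≥ 0`. [folklore] -/
private theorem tsum_nonneg_of_leibniz {c : ℕ → ℝ} (hs : Summable c) (halt : ∀ i, c i * c (i + 1) ≤ 0)
    (hmono : ∀ i, |c (i + 1)| ≤ |c i|) (h0 : 0 ≤ c 0) : 0 ≤ ∑' i, c i := by
  have he : Summable fun k => c (2 * k) := hs.comp_injective (mul_right_injective₀ (two_ne_zero' ℕ))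
  have ho : Summable fun k => c (2 * k + 1) :=
    hs.comp_injective ((add_left_injective 1).comp (mul_right_injective₀ (two_ne_zero' ℕ)))
  rw [← tsum_even_add_odd he ho, ← he.tsum_add ho]
  exact tsum_nonneg fun k => (leibniz_pairs halt hmono h0 k).2

/-- The sum of a summable Leibniz sequence lies between `0` and its first term. [folklore] -/
private theorem tsum_mem_of_leibniz {c : ℕ → ℝ} (hs : Summable c) (halt : ∀ i, c i * c (i + 1) ≤ 0)
    (hmono : ∀ i, |c (i + 1)| ≤ |c i|) (h0 : 0 ≤ c 0) : 0 ≤ ∑' i, c i ∧ ∑' i, c i ≤ c 0 := by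
  refine ⟨tsum_nonneg_of_leibniz hs halt hmono h0, ?_⟩
  have h1 : c (0 + 1) ≤ 0 := nonpos_succ_of_nonneg h0 (halt 0) (hmono 0)
  have hc1 : Summable fun i => c (i + 1) := (summable_nat_add_iff 1).2 hs
  have hneg : 0 ≤ ∑' i, -c (i + 1) :=
    tsum_nonneg_of_leibniz hc1.neg (fun i => by simpa using halt (i + 1))
      (fun i => by simpa only [abs_neg] using hmono (i + 1)) (by simpa using h1)
  rw [tsum_neg] at hneg
  rw [hs.tsum_eq_zero_add]
  linarith

/-- **The Leibniz bracket**: for a summable sequence whose terms alternate in sign (`aₙ aₙ₊₁ ≤ 0`) and do not grow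
in modulus (`|aₙ₊₁| ≤ |aₙ|`) from `N` on, the tail `∑_{n ≥ N} aₙ` lies between `0` and `a_N`.  Stated for Mathlib's
unconditional `tsum`: summability (absolute) is a hypothesis. [cite: BreuerZwas1993, Sect. 6.2 (6.9)–(6.10)] -/
theorem tsum_shift_mem_of_alternating (hs : Summable a) (halt : ∀ n, N ≤ n → a n * a (n + 1) ≤ 0)
    (hmono : ∀ n, N ≤ n → |a (n + 1)| ≤ |a n|) :
    min (a N) 0 ≤ ∑' k, a (k + N) ∧ ∑' k, a (k + N) ≤ max (a N) 0 := by
  have hsN : Summable fun k => a (k + N) := (summable_nat_add_iff N).2 hs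
  have e1 : ∀ k : ℕ, k + 1 + N = k + N + 1 := fun k => by omega
  have haltN : ∀ k : ℕ, a (k + N) * a (k + 1 + N) ≤ 0 := fun k => by
    rw [e1]; exact halt _ (Nat.le_add_left N k)
  have hmonoN : ∀ k : ℕ, |a (k + 1 + N)| ≤ |a (k + N)| := fun k => by
    rw [e1]; exact hmono _ (Nat.le_add_left N k)
  rcases le_total 0 (a N) with hN | hN
  · have h := tsum_mem_of_leibniz hsN haltN hmonoN (by simpa using hN)
    simp only [zero_add] at h
    rw [min_eq_right hN, max_eq_left hN]
    exact h
  · have h := tsum_mem_of_leibniz (c := fun k => -a (k + N)) hsN.neg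
      (fun k => by simpa using haltN k) (fun k => by simpa only [abs_neg] using hmonoN k)
      (by simpa using hN)
    rw [tsum_neg] at h
    simp only [zero_add] at h
    rw [min_eq_left hN, max_eq_right hN]
    constructor <;> linarith [h.1, h.2]

/-- **The Leibniz bracket for the whole sum**: `S(N) + min(a_N, 0) ≤ ∑' n, a n ≤ S(N) + max(a_N, 0)`.
[cite: BreuerZwas1993, Sect. 6.2 (6.9)–(6.10)] -/
theorem tsum_bounds_of_alternating (hs : Summable a) (halt : ∀ n, N ≤ n → a n * a (n + 1) ≤ 0)
    (hmono : ∀ n, N ≤ n → |a (n + 1)| ≤ |a n|) :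
    (∑ i ∈ Finset.range N, a i) + min (a N) 0 ≤ ∑' n, a n ∧
      ∑' n, a n ≤ (∑ i ∈ Finset.range N, a i) + max (a N) 0 := by
  have h := tsum_shift_mem_of_alternating hs halt hmono
  have hsplit : ∑' n, a n = (∑ i ∈ Finset.range N, a i) + ∑' k, a (k + N) :=
    (hs.sum_add_tsum_nat_add N).symm
  rw [hsplit]
  constructor <;> linarith [h.1, h.2]

/-- **The integral-test bracket**: for `f` non-negative, antitone and integrable on `[N, ∞)`,
`∑_{i<N} f(i) + ∫_N^∞ f ≤ ∑' n, f n ≤ ∑_{i≤N} f(i) + ∫_N^∞ f` (Jameson: `I*(n) ≤ S*(n − 1)`, `S*(n) ≤ I*(n)`).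
[cite: Jameson2003, Prop. 1.4.4] -/
theorem tsum_bounds_of_antitoneOn {f : ℝ → ℝ} {N : ℕ} (hf : AntitoneOn f (Ici (N : ℝ)))
    (hint : MeasureTheory.IntegrableOn f (Ioi (N : ℝ))) (hpos : ∀ t ∈ Ioi (N : ℝ), 0 ≤ f t) :
    Summable (fun n : ℕ => f n) ∧
      (∑ i ∈ Finset.range N, f i) + ∫ t in Ioi (N : ℝ), f t ≤ ∑' n : ℕ, f n ∧
        ∑' n : ℕ, f n ≤ (∑ i ∈ Finset.range (N + 1), f i) + ∫ t in Ioi (N : ℝ), f t := by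
  have hs : Summable fun n : ℕ => f n := hf.summable_of_integrableOn_Ioi hint hpos
  have hup : ∑' n : ℕ, f (n + N + 1 : ℕ) ≤ ∫ t in Ioi (N : ℝ), f t :=
    hf.tsum_comp_add_le_integral N hint hpos
  have hlo : ∫ t in Ioi (N : ℝ), f t ≤ ∑' n : ℕ, f (n + N : ℕ) := hf.integral_le_tsum_comp_add N hs hpos
  have e1 : ∑' n : ℕ, f n = (∑ i ∈ Finset.range N, f i) + ∑' n : ℕ, f (n + N : ℕ) :=
    (hs.sum_add_tsum_nat_add N).symm
  have e2 : ∑' n : ℕ, f n = (∑ i ∈ Finset.range (N + 1), f i) + ∑' n : ℕ, f (n + (N + 1) : ℕ) :=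
    (hs.sum_add_tsum_nat_add (N + 1)).symm
  have e3 : ∑' n : ℕ, f (n + (N + 1) : ℕ) = ∑' n : ℕ, f (n + N + 1 : ℕ) :=
    tsum_congr fun n => by rw [Nat.add_assoc]
  refine ⟨hs, by rw [e1]; linarith, ?_⟩
  rw [e2, e3]
  linarith

end Tails

/-! ### Part B. Exact-rational kernels: eventual signs of polynomials, hypergeometric terms, rounded sums -/

/-- `recenterAt g c` evaluates to `g(c + u)`. [folklore] -/
private theorem eval_recenterAt_eq (g : Poly) (c : ℚ) (u : ℝ) :
    Poly.eval (recenterAt g c) u = Poly.eval g ((c : ℝ) + u) := by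
  rw [recenterAt, BPoly.eval_subst, BPoly.eval_taylor]
  simp [Poly.eval, add_comm]

/-- A coefficient list with non-negative entries evaluates to `≥ 0` at `u ≥ 0`. [folklore] -/
private theorem eval_nonneg_of_coeffs :
    ∀ (P : Poly), (∀ c ∈ P, (0 : ℚ) ≤ c) → ∀ {u : ℝ}, 0 ≤ u → 0 ≤ Poly.eval P u
  | [], _, _, _ => by simp
  | c :: P, h, u, hu => by
      rw [Poly.eval_cons]
      have hc : (0 : ℝ) ≤ (c : ℝ) := by exact_mod_cast h c (by simp)
      have hP := eval_nonneg_of_coeffs P (fun d hd => h d (by simp [hd])) hu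
      exact add_nonneg hc (mul_nonneg hu hP)

/-- … and to `> 0` if the constant coefficient is positive. [folklore] -/
private theorem eval_pos_of_coeffs :
    ∀ (P : Poly), (∀ c ∈ P, (0 : ℚ) ≤ c) → 0 < P.headD 0 → ∀ {u : ℝ}, 0 ≤ u → 0 < Poly.eval P u
  | [], _, h0, _, _ => by simp at h0
  | c :: P, h, h0, u, hu => by
      rw [Poly.eval_cons]
      simp only [List.headD_cons] at h0
      have hc : (0 : ℝ) < (c : ℝ) := by exact_mod_cast h0
      have hP := eval_nonneg_of_coeffs P (fun d hd => h d (by simp [hd])) hu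
      exact add_pos_of_pos_of_nonneg hc (mul_nonneg hu hP)

/-- **Eventual non-negativity certificate of a rational polynomial**: every Taylor coefficient of `P(x₀ + u)` is
`≥ 0` (zero sign variations after the shift: Descartes' bound), so `P ≥ 0` on `[x₀, ∞)`.
[cite: BasuPollackRoy2006, Sect. 2.2.1 Thm. 2.33] -/
def nonnegFrom (P : Poly) (x0 : ℚ) : Bool :=
  (recenterAt P x0).all fun c => decide (0 ≤ c)

/-- **Eventual positivity certificate**: `nonnegFrom` and the constant coefficient of `P(x₀ + u)` is `> 0`, so
`P > 0` on `[x₀, ∞)`. [cite: BasuPollackRoy2006, Sect. 2.2.1 Thm. 2.33] -/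
def posFrom (P : Poly) (x0 : ℚ) : Bool :=
  nonnegFrom P x0 && decide (0 < (recenterAt P x0).headD 0)

/-- Soundness of `nonnegFrom`: `0 ≤ P(x)` for every real `x ≥ x₀`. [cite: BasuPollackRoy2006, Sect. 2.2.1 Thm. 2.33] -/
theorem eval_nonneg_of_nonnegFrom {P : Poly} {x0 : ℚ} (h : nonnegFrom P x0 = true) {x : ℝ}
    (hx : ((x0 : ℚ) : ℝ) ≤ x) : 0 ≤ Poly.eval P x := by
  unfold nonnegFrom at h
  rw [List.all_eq_true] at h
  have h' : ∀ c ∈ recenterAt P x0, (0 : ℚ) ≤ c := fun c hc => of_decide_eq_true (h c hc)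
  have e : x = ((x0 : ℚ) : ℝ) + (x - x0) := by ring
  rw [e, ← eval_recenterAt_eq]
  exact eval_nonneg_of_coeffs _ h' (by linarith)

/-- Soundness of `posFrom`: `0 < P(x)` for every real `x ≥ x₀`. [cite: BasuPollackRoy2006, Sect. 2.2.1 Thm. 2.33] -/
theorem eval_pos_of_posFrom {P : Poly} {x0 : ℚ} (h : posFrom P x0 = true) {x : ℝ}
    (hx : ((x0 : ℚ) : ℝ) ≤ x) : 0 < Poly.eval P x := by
  unfold posFrom nonnegFrom at h
  simp only [Bool.and_eq_true, decide_eq_true_eq, List.all_eq_true] at h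
  obtain ⟨hnn, hhd⟩ := h
  have e : x = ((x0 : ℚ) : ℝ) + (x - x0) := by ring
  rw [e, ← eval_recenterAt_eq]
  exact eval_pos_of_coeffs _ (fun c hc => hnn c hc) hhd (by linarith)

/-- Exact evaluation at a natural number, cast to `ℝ`. [folklore] -/
private theorem cast_evalQ_nat (p : Poly) (n : ℕ) : ((p.evalQ n : ℚ) : ℝ) = Poly.eval p n := by
  rw [Poly.eval_evalQ]; simp

/-- **Hypergeometric terms and partial sums, exactly**: `hypAcc a₀ num den n = (tₙ, ∑_{i<n} tᵢ)` for the first-order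
recurrence `tₙ₊₁ = tₙ · num(n)/den(n)`, `t₀ = a₀` — the term ratio a rational function of the index.
[cite: Johansson2019, Sect. 2] [cite: Johansson2019, Sect. 4] -/
def hypAcc (a0 : ℚ) (num den : Poly) : ℕ → ℚ × ℚ
  | 0 => (a0, 0)
  | n + 1 =>
      let p := hypAcc a0 num den n
      (p.1 * (num.evalQ n / den.evalQ n), p.2 + p.1)

/-- The `n`-th hypergeometric term `tₙ`. [cite: Johansson2019, Sect. 2] -/
def hypTerm (a0 : ℚ) (num den : Poly) (n : ℕ) : ℚ := (hypAcc a0 num den n).1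

/-- The truncated sum `S(n) = ∑_{i<n} tᵢ`. [cite: Johansson2019, Sect. 4] -/
def hypSum (a0 : ℚ) (num den : Poly) (n : ℕ) : ℚ := (hypAcc a0 num den n).2

/-- The first term is `a₀`. [cite: Johansson2019, Sect. 2] -/
theorem hypTerm_zero (a0 : ℚ) (num den : Poly) : hypTerm a0 num den 0 = a0 := rfl

/-- The recurrence `tₙ₊₁ = tₙ·num(n)/den(n)`. [cite: Johansson2019, Sect. 2] -/
theorem hypTerm_succ (a0 : ℚ) (num den : Poly) (n : ℕ) :
    hypTerm a0 num den (n + 1) = hypTerm a0 num den n * (num.evalQ n / den.evalQ n) := rfl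

/-- `S(n+1) = S(n) + tₙ`. [cite: Johansson2019, Sect. 4] -/
theorem hypSum_succ (a0 : ℚ) (num den : Poly) (n : ℕ) :
    hypSum a0 num den (n + 1) = hypSum a0 num den n + hypTerm a0 num den n := rfl

/-- The truncated sum is the sum of the terms. [cite: Johansson2019, Sect. 4] -/
theorem hypSum_eq_sum (a0 : ℚ) (num den : Poly) :
    ∀ n : ℕ, ((hypSum a0 num den n : ℚ) : ℝ) = ∑ i ∈ Finset.range n, ((hypTerm a0 num den i : ℚ) : ℝ)
  | 0 => by simp [hypSum, hypAcc]
  | n + 1 => by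
      rw [hypSum_succ, Rat.cast_add, hypSum_eq_sum a0 num den n, Finset.sum_range_succ]

/-- **Identification**: a real sequence with `a 0 = a₀` and `aₙ₊₁·den(n) = aₙ·num(n)`, `den(n) ≠ 0`, IS the exact
term sequence. [cite: Johansson2019, Sect. 2] -/
theorem eq_hypTerm {a : ℕ → ℝ} {a0 : ℚ} {num den : Poly} (h0 : a 0 = a0)
    (hrec : ∀ n : ℕ, a (n + 1) * Poly.eval den n = a n * Poly.eval num n)
    (hden : ∀ n : ℕ, Poly.eval den n ≠ 0) : ∀ n : ℕ, a n = hypTerm a0 num den n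
  | 0 => by rw [h0, hypTerm_zero]
  | n + 1 => by
      have ih := eq_hypTerm h0 hrec hden n
      have hd := hden n
      have e1 : a (n + 1) = a (n + 1) * Poly.eval den n / Poly.eval den n :=
        (mul_div_cancel_right₀ _ hd).symm
      rw [e1, hrec n, ih, hypTerm_succ]
      push_cast
      rw [cast_evalQ_nat, cast_evalQ_nat, mul_div_assoc]

/-- **The exact ratio certificate from index `N`**: `0 ≤ qn < qd`; `den(i) ≠ 0` for `i < N`; and, by three
eventual-sign certificates, `den > 0`, `qn·den − qd·num ≥ 0` and `qn·den + qd·num ≥ 0` on `[N, ∞)` — so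
`|tₙ₊₁/tₙ| = |num(n)|/den(n) ≤ qn/qd < 1` for all `n ≥ N`.
[cite: Johansson2019, Sect. 4.1 Thm. 1] [cite: BasuPollackRoy2006, Sect. 2.2.1 Thm. 2.33] -/
def hypRatioCheck (num den : Poly) (N : ℕ) (qn qd : ℚ) : Bool :=
  decide (0 ≤ qn) && decide (qn < qd) &&
    ((List.range N).all fun i => !decide (den.evalQ i = 0)) && posFrom den N &&
    nonnegFrom (Poly.add (Poly.smul qn den) (Poly.smul (-qd) num)) N &&
    nonnegFrom (Poly.add (Poly.smul qn den) (Poly.smul qd num)) N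

/-- The three summation modes: two-sided geometric tail, alternating (Leibniz) tail, constant-sign tail.
[cite: Johansson2019, Sect. 4.1 Thm. 1] [cite: BreuerZwas1993, Sect. 6.2 (6.9)–(6.10)] -/
inductive SMode : Type
  /-- two-sided geometric tail bound `± |t_N|·qd/(qd − qn)` -/
  | geom : SMode
  /-- alternating from `N` on (`num < 0` there): the Leibniz bracket `[min(t_N, 0), max(t_N, 0)]` -/
  | alt : SMode
  /-- constant sign from `N` on (`num > 0` there) with `t_N ≥ 0`: `[t_N, t_N·qd/(qd − qn)]` -/
  | pos : SMode
  deriving DecidableEq, Inhabited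

/-- **The series certificate** of mode `m` (ONE `decide`): the ratio certificate, plus `num < 0` on `[N, ∞)` (`alt`),
resp. `num > 0` on `[N, ∞)` and `t_N ≥ 0` (`pos`). [cite: Johansson2019, Sect. 4.1 Thm. 1]
[cite: BreuerZwas1993, Sect. 6.2 (6.9)–(6.10)] -/
def hypCheck (a0 : ℚ) (num den : Poly) (N : ℕ) (qn qd : ℚ) : SMode → Bool
  | .geom => hypRatioCheck num den N qn qd
  | .alt => hypRatioCheck num den N qn qd && posFrom (Poly.smul (-1) num) N
  | .pos => hypRatioCheck num den N qn qd && posFrom num N && decide (0 ≤ hypTerm a0 num den N)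

/-- **The exact enclosure** `(lo, hi)` of mode `m`: `S(N) ∓ |t_N|·qd/(qd − qn)` (`geom`),
`S(N) + [min(t_N, 0), max(t_N, 0)]` (`alt`), `S(N) + [t_N, t_N·qd/(qd − qn)]` (`pos`).
[cite: Johansson2019, Sect. 4.1 Thm. 1] [cite: BreuerZwas1993, Sect. 6.2 (6.9)–(6.10)] -/
def hypBounds (a0 : ℚ) (num den : Poly) (N : ℕ) (qn qd : ℚ) : SMode → ℚ × ℚ
  | .geom =>
      let p := hypAcc a0 num den N
      (p.2 - |p.1| * qd / (qd - qn), p.2 + |p.1| * qd / (qd - qn))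
  | .alt =>
      let p := hypAcc a0 num den N
      (p.2 + min p.1 0, p.2 + max p.1 0)
  | .pos =>
      let p := hypAcc a0 num den N
      (p.2 + p.1, p.2 + p.1 * qd / (qd - qn))

/-- **Outward-rounded partial sums** of a computable rational sequence at scale `S`:
`(∑_{i<n} t(n₀ + i))·S ∈ qsumI S t n₀ n` (one `ofRat` rounding per term). [cite: Johansson2019, Sect. 4]
[cite: Moore1979, Sect. 2.2 (2.16)–(2.21)] -/
def qsumI (S : ℕ) (t : ℕ → ℚ) (n0 : ℕ) : ℕ → MI
  | 0 => ⟨0, 0⟩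
  | n + 1 => (qsumI S t n0 n).add (ofRat S (t (n0 + n)))

/-- Soundness of `qsumI`. [cite: Moore1979, Sect. 2.2 (2.16)–(2.21)] -/
theorem mem_qsumI (S : ℕ) (t : ℕ → ℚ) (n0 : ℕ) :
    ∀ n : ℕ, MI.mem S (∑ i ∈ Finset.range n, ((t (n0 + i) : ℚ) : ℝ)) (qsumI S t n0 n)
  | 0 => by simp [qsumI, MI.mem]
  | n + 1 => by
      rw [Finset.sum_range_succ, qsumI]
      exact MI.mem_add (mem_qsumI S t n0 n) (mem_ofRat S _)

/-! ### Part B′. Statement-family kernels: head sums by point models; ratio and sign certificates on a box -/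

namespace OpModel

variable (M : OpModel)

/-- **The head sum by point models**: the folded point enclosures of `P(ps; idx(n₀ + i))·S`, `i < n` (candidates
`css i` for the `i`-th point), with the conjunctive acceptance flag. [cite: MakinoBerz2003, Algorithm 2]
[cite: Johansson2019, Sect. 4] -/
def headSumI (prm : M.Prm) (S : ℕ) (p : GProg M) (B : PBox) (idx : ℕ → ℚ)
    (css : ℕ → List (List ℤ × ℕ)) (n0 : ℕ) : ℕ → MI × Bool
  | 0 => (⟨0, 0⟩, true)
  | n + 1 =>
      let R := headSumI prm S p B idx css n0 n
      let Y := M.pointI prm S p B (idx (n0 + n)) (css (n0 + n))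
      (R.1.add Y.1, R.2 && Y.2)

/-- **The ratio certificate on a box**: the panel models of the programs `pN` (numerator) and `pD` (denominator) on
`|u − u₀| ≤ h`, uniformly over the parameter box, are accepted; `0 ≤ qn < qd`; the denominator's lower range bound
is positive; and `qd·tabsI(Num) ≤ qn·tlowerI(Den)` — so `Den(ps; u) > 0` and `qd·|Num(ps; u)| ≤ qn·Den(ps; u)` on
the box. [cite: MakinoBerz2003, Algorithm 2] [cite: Johansson2019, Sect. 4.1 Thm. 1] -/
def ratioCheck (prm : M.Prm) (S : ℕ) (pN pD : GProg M) (B : PBox) (u0 h : ℚ)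
    (csN csD : List (List ℤ × ℕ)) (qn qd : ℚ) : Bool :=
  let WN := M.pmodelP prm S h u0 pN B csN
  let WD := M.pmodelP prm S h u0 pD B csD
  decide (0 < S) && decide (0 ≤ h) && decide (0 ≤ qn) && decide (qn < qd) && WN.2 && WD.2 &&
    decide (0 < tlowerI S h WD.1) &&
    decide (qd * ((tabsI S h WN.1 : ℤ) : ℚ) ≤ qn * ((tlowerI S h WD.1 : ℤ) : ℚ))

/-- **Negativity certificate of a program on a box** `|u − u₀| ≤ h`: accepted panel model with `tupperI < 0`.
[cite: MakinoBerz2003, Algorithm 2] -/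
def negOnCheck (prm : M.Prm) (S : ℕ) (p : GProg M) (B : PBox) (u0 h : ℚ) (cs : List (List ℤ × ℕ)) : Bool :=
  let W := M.pmodelP prm S h u0 p B cs
  decide (0 < S) && decide (0 ≤ h) && W.2 && decide (tupperI S h W.1 < 0)

/-- **Positivity certificate of a program on a box** `|u − u₀| ≤ h`: accepted panel model with `tlowerI > 0`.
[cite: MakinoBerz2003, Algorithm 2] -/
def posOnCheck (prm : M.Prm) (S : ℕ) (p : GProg M) (B : PBox) (u0 h : ℚ) (cs : List (List ℤ × ℕ)) : Bool :=
  let W := M.pmodelP prm S h u0 p B cs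
  decide (0 < S) && decide (0 ≤ h) && W.2 && decide (0 < tlowerI S h W.1)

end OpModel

namespace OpSem

variable {M : OpModel} (F : OpSem M)

/-- **Soundness of the head sum**: `(∑_{i<n} P(ps; idx(n₀ + i)))·S ∈ headSumI`, for every parameter vector of the
box. [cite: MakinoBerz2003, Algorithm 2] [cite: Johansson2019, Sect. 4] -/
theorem mem_headSumI {prm : M.Prm} {S : ℕ} (hS : 0 < S) {p : GProg M} {B : PBox} {idx : ℕ → ℚ}
    {css : ℕ → List (List ℤ × ℕ)} {n0 : ℕ} {ps : List ℝ} (hB : BoxMem ps B) :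
    ∀ n : ℕ, (M.headSumI prm S p B idx css n0 n).2 = true →
      MI.mem S (∑ i ∈ Finset.range n, F.toFunP p ps (((idx (n0 + i) : ℚ) : ℝ)))
        (M.headSumI prm S p B idx css n0 n).1
  | 0, _ => by simp [OpModel.headSumI, MI.mem]
  | n + 1, h => by
      simp only [OpModel.headSumI, Bool.and_eq_true] at h
      rw [Finset.sum_range_succ, OpModel.headSumI]
      exact MI.mem_add (mem_headSumI hS hB n h.1) (F.mem_pointI hS h.2 hB)

/-- **Soundness of the ratio certificate on a box**: `0 ≤ qn < qd`, and for every parameter vector of the box and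
every `u` with `|u − u₀| ≤ h`, `Den(ps; u) > 0` and `qd·|Num(ps; u)| ≤ qn·Den(ps; u)`.
[cite: MakinoBerz2003, Algorithm 2] [cite: Johansson2019, Sect. 4.1 Thm. 1] -/
theorem pos_and_ratio_le_of_ratioCheck {prm : M.Prm} {S : ℕ} {pN pD : GProg M} {B : PBox} {u0 h : ℚ}
    {csN csD : List (List ℤ × ℕ)} {qn qd : ℚ}
    (hc : M.ratioCheck prm S pN pD B u0 h csN csD qn qd = true) {ps : List ℝ} (hB : BoxMem ps B)
    {u : ℝ} (hu : |u - u0| ≤ h) :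
    (0 : ℚ) ≤ qn ∧ qn < qd ∧ 0 < F.toFunP pD ps u ∧
      ((qd : ℚ) : ℝ) * |F.toFunP pN ps u| ≤ ((qn : ℚ) : ℝ) * F.toFunP pD ps u := by
  unfold OpModel.ratioCheck at hc
  simp only [Bool.and_eq_true, decide_eq_true_eq] at hc
  obtain ⟨⟨⟨⟨⟨⟨⟨hS, h0⟩, hqn⟩, hq⟩, hokN⟩, hokD⟩, hlow⟩, hrat⟩ := hc
  have hWN := F.tmem_pmodelP prm hS h0 u0 pN hB csN hokN
  have hWD := F.tmem_pmodelP prm hS h0 u0 pD hB csD hokD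
  have hu' : |u - u0| ≤ (h : ℝ) := hu
  have h1 := abs_le_tabsI h0 hWN hu'
  have h2 := tlowerI_le h0 hWD hu'
  simp only [add_sub_cancel] at h1 h2
  have hSr : (0 : ℝ) < S := by exact_mod_cast hS
  have hlow' : (0 : ℝ) < ((tlowerI S h (M.pmodelP prm S h u0 pD B csD).1 : ℤ) : ℝ) := by exact_mod_cast hlow
  have hrat' : ((qd : ℚ) : ℝ) * ((tabsI S h (M.pmodelP prm S h u0 pN B csN).1 : ℤ) : ℝ) ≤
      ((qn : ℚ) : ℝ) * ((tlowerI S h (M.pmodelP prm S h u0 pD B csD).1 : ℤ) : ℝ) := by exact_mod_cast hrat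
  have hqn' : (0 : ℝ) ≤ ((qn : ℚ) : ℝ) := by exact_mod_cast hqn
  have hqd' : (0 : ℝ) ≤ ((qd : ℚ) : ℝ) := by
    have : (qn : ℝ) < qd := by exact_mod_cast hq
    linarith
  have hD : 0 < F.toFunP pD ps u := by
    rcases le_or_gt (F.toFunP pD ps u) 0 with hcon | hlt
    · have : F.toFunP pD ps u * S ≤ 0 := mul_nonpos_of_nonpos_of_nonneg hcon hSr.le
      linarith
    · exact hlt
  refine ⟨hqn, hq, hD, ?_⟩
  have h3 : ((qd : ℚ) : ℝ) * (|F.toFunP pN ps u| * S) ≤ ((qn : ℚ) : ℝ) * (F.toFunP pD ps u * S) := by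
    calc ((qd : ℚ) : ℝ) * (|F.toFunP pN ps u| * S)
        ≤ ((qd : ℚ) : ℝ) * ((tabsI S h (M.pmodelP prm S h u0 pN B csN).1 : ℤ) : ℝ) :=
          mul_le_mul_of_nonneg_left h1 hqd'
      _ ≤ ((qn : ℚ) : ℝ) * ((tlowerI S h (M.pmodelP prm S h u0 pD B csD).1 : ℤ) : ℝ) := hrat'
      _ ≤ ((qn : ℚ) : ℝ) * (F.toFunP pD ps u * S) := mul_le_mul_of_nonneg_left h2 hqn'
  have h4 : (((qd : ℚ) : ℝ) * |F.toFunP pN ps u|) * S ≤ (((qn : ℚ) : ℝ) * F.toFunP pD ps u) * S := by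
    simpa only [mul_assoc] using h3
  exact le_of_mul_le_mul_right h4 hSr

/-- **Soundness of the negativity certificate**: `P(ps; u) < 0` on the box. [cite: MakinoBerz2003, Algorithm 2] -/
theorem neg_of_negOnCheck {prm : M.Prm} {S : ℕ} {p : GProg M} {B : PBox} {u0 h : ℚ}
    {cs : List (List ℤ × ℕ)} (hc : M.negOnCheck prm S p B u0 h cs = true) {ps : List ℝ} (hB : BoxMem ps B)
    {u : ℝ} (hu : |u - u0| ≤ h) : F.toFunP p ps u < 0 := by
  unfold OpModel.negOnCheck at hc
  simp only [Bool.and_eq_true, decide_eq_true_eq] at hc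
  obtain ⟨⟨⟨hS, h0⟩, hok⟩, hup⟩ := hc
  have hW := F.tmem_pmodelP prm hS h0 u0 p hB cs hok
  have hu' : |u - u0| ≤ (h : ℝ) := hu
  have h1 := le_tupperI h0 hW hu'
  simp only [add_sub_cancel] at h1
  have hup' : ((tupperI S h (M.pmodelP prm S h u0 p B cs).1 : ℤ) : ℝ) < 0 := by exact_mod_cast hup
  have hSr : (0 : ℝ) < S := by exact_mod_cast hS
  rcases lt_or_ge (F.toFunP p ps u) 0 with hlt | hcon
  · exact hlt
  · have : 0 ≤ F.toFunP p ps u * S := mul_nonneg hcon hSr.le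
    linarith

/-- **Soundness of the positivity certificate**: `P(ps; u) > 0` on the box. [cite: MakinoBerz2003, Algorithm 2] -/
theorem pos_of_posOnCheck {prm : M.Prm} {S : ℕ} {p : GProg M} {B : PBox} {u0 h : ℚ}
    {cs : List (List ℤ × ℕ)} (hc : M.posOnCheck prm S p B u0 h cs = true) {ps : List ℝ} (hB : BoxMem ps B)
    {u : ℝ} (hu : |u - u0| ≤ h) : 0 < F.toFunP p ps u := by
  unfold OpModel.posOnCheck at hc
  simp only [Bool.and_eq_true, decide_eq_true_eq] at hc
  obtain ⟨⟨⟨hS, h0⟩, hok⟩, hlow⟩ := hc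
  have hW := F.tmem_pmodelP prm hS h0 u0 p hB cs hok
  have hu' : |u - u0| ≤ (h : ℝ) := hu
  have h1 := tlowerI_le h0 hW hu'
  simp only [add_sub_cancel] at h1
  have hlow' : (0 : ℝ) < ((tlowerI S h (M.pmodelP prm S h u0 p B cs).1 : ℤ) : ℝ) := by exact_mod_cast hlow
  have hSr : (0 : ℝ) < S := by exact_mod_cast hS
  rcases le_or_gt (F.toFunP p ps u) 0 with hcon | hlt
  · have : F.toFunP p ps u * S ≤ 0 := mul_nonpos_of_nonpos_of_nonneg hcon hSr.le
    linarith
  · exact hlt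

end OpSem

/-! ### Part C. The assembled enclosures -/

section Hypergeometric

variable {a : ℕ → ℝ} {a0 : ℚ} {num den : Poly} {N : ℕ} {qn qd : ℚ}

/-- What the exact ratio certificate gives: `0 ≤ qn < qd`, `den` never vanishes at a natural number, and from `N`
on `den > 0` and `qd·|num| ≤ qn·den`. [cite: Johansson2019, Sect. 4.1 Thm. 1] -/
theorem hypRatioCheck_sound (hc : hypRatioCheck num den N qn qd = true) :
    0 ≤ qn ∧ qn < qd ∧ (∀ n : ℕ, Poly.eval den n ≠ 0) ∧
      ∀ n : ℕ, N ≤ n → 0 < Poly.eval den n ∧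
        ((qd : ℚ) : ℝ) * |Poly.eval num n| ≤ ((qn : ℚ) : ℝ) * Poly.eval den n := by
  unfold hypRatioCheck at hc
  simp only [Bool.and_eq_true, decide_eq_true_eq, List.all_eq_true, Bool.not_eq_true',
    decide_eq_false_iff_not] at hc
  obtain ⟨⟨⟨⟨⟨hqn, hq⟩, hfin⟩, hpos⟩, hm⟩, hp⟩ := hc
  have hposN : ∀ n : ℕ, N ≤ n → 0 < Poly.eval den n := fun n hn =>
    eval_pos_of_posFrom hpos (by exact_mod_cast hn)
  refine ⟨hqn, hq, fun n => ?_, fun n hn => ⟨hposN n hn, ?_⟩⟩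
  · rcases lt_or_ge n N with hlt | hge
    · have h1 : den.evalQ n ≠ 0 := hfin n (List.mem_range.2 hlt)
      rw [← cast_evalQ_nat]
      exact_mod_cast h1
    · exact (hposN n hge).ne'
  · have h1 := eval_nonneg_of_nonnegFrom hm (x := (n : ℝ)) (by exact_mod_cast hn)
    have h2 := eval_nonneg_of_nonnegFrom hp (x := (n : ℝ)) (by exact_mod_cast hn)
    rw [Poly.eval_add, Poly.eval_smul, Poly.eval_smul] at h1 h2
    push_cast at h1 h2
    have hqd : (0 : ℝ) ≤ ((qd : ℚ) : ℝ) := by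
      have h3 : ((qn : ℚ) : ℝ) < qd := by exact_mod_cast hq
      have h4 : (0 : ℝ) ≤ ((qn : ℚ) : ℝ) := by exact_mod_cast hqn
      linarith
    rcases le_total 0 (Poly.eval num n) with hcase | hcase
    · rw [abs_of_nonneg hcase]; linarith
    · rw [abs_of_nonpos hcase]; linarith

/-- From the ratio certificate and the recurrence: the terms are the exact ones, and the ratio majorant
`|aₙ₊₁| ≤ (qn/qd)|aₙ|` holds from `N` on. [cite: Johansson2019, Sect. 4.1 Thm. 1] -/
theorem ratio_of_hypRatioCheck (hc : hypRatioCheck num den N qn qd = true) (h0 : a 0 = a0)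
    (hrec : ∀ n : ℕ, a (n + 1) * Poly.eval den n = a n * Poly.eval num n) :
    (∀ n : ℕ, a n = hypTerm a0 num den n) ∧
      ∀ n : ℕ, N ≤ n → |a (n + 1)| ≤ (((qn / qd : ℚ) : ℝ)) * |a n| := by
  obtain ⟨hqn, hq, hden, hrat⟩ := hypRatioCheck_sound hc
  refine ⟨eq_hypTerm h0 hrec hden, fun n hn => ?_⟩
  obtain ⟨hD, hR⟩ := hrat n hn
  have hqd : (0 : ℝ) < ((qd : ℚ) : ℝ) := by
    have h1 : ((qn : ℚ) : ℝ) < qd := by exact_mod_cast hq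
    have h2 : (0 : ℝ) ≤ ((qn : ℚ) : ℝ) := by exact_mod_cast hqn
    linarith
  have e : |a (n + 1)| * Poly.eval den n = |a n| * |Poly.eval num n| := by
    rw [← abs_of_pos hD, ← abs_mul, hrec n, abs_mul]
  -- |a (n+1)| · den ≤ |a n| · (qn/qd) · den
  have h3 : |a (n + 1)| * Poly.eval den n ≤ (((qn / qd : ℚ) : ℝ) * |a n|) * Poly.eval den n := by
    rw [e]
    have h4 : |a n| * (((qd : ℚ) : ℝ) * |Poly.eval num n|) ≤ |a n| * (((qn : ℚ) : ℝ) * Poly.eval den n) :=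
      mul_le_mul_of_nonneg_left hR (abs_nonneg _)
    have h5 : |a n| * |Poly.eval num n| = (|a n| * (((qd : ℚ) : ℝ) * |Poly.eval num n|)) / ((qd : ℚ) : ℝ) := by
      field_simp
    rw [h5, div_le_iff₀ hqd]
    push_cast
    have h6 : ((qn : ℝ) / qd * |a n|) * Poly.eval den n * (qd : ℝ) = |a n| * ((qn : ℝ) * Poly.eval den n) := by
      field_simp
    rw [h6]
    exact h4
  exact le_of_mul_le_mul_right h3 hD

/-- **The assembled exact enclosure of a hypergeometric series**: ONE `decide` of `hypCheck a₀ num den N qn qd m`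
plus the identifications `a 0 = a₀` and `aₙ₊₁·den(n) = aₙ·num(n)` give `Summable a` and
`lo ≤ ∑' n, a n ≤ hi` with the exact rationals `(lo, hi) = hypBounds a₀ num den N qn qd m`.
[cite: Johansson2019, Sect. 4.1 Thm. 1] [cite: BreuerZwas1993, Sect. 6.2 (6.9)–(6.10)] -/
theorem hyp_tsum_bounds {m : SMode} (hc : hypCheck a0 num den N qn qd m = true) (h0 : a 0 = a0)
    (hrec : ∀ n : ℕ, a (n + 1) * Poly.eval den n = a n * Poly.eval num n) :
    Summable a ∧ (((hypBounds a0 num den N qn qd m).1 : ℚ) : ℝ) ≤ ∑' n, a n ∧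
      ∑' n, a n ≤ (((hypBounds a0 num den N qn qd m).2 : ℚ) : ℝ) := by
  -- the common part
  have hcr : hypRatioCheck num den N qn qd = true := by
    cases m <;> simp only [hypCheck, Bool.and_eq_true] at hc <;> tauto
  obtain ⟨hqn, hq, hden, hrat⟩ := hypRatioCheck_sound hcr
  obtain ⟨heq, hratio⟩ := ratio_of_hypRatioCheck hcr h0 hrec
  have hq0 : (0 : ℝ) ≤ ((qn / qd : ℚ) : ℝ) := by
    have h1 : (0 : ℝ) ≤ ((qn : ℚ) : ℝ) := by exact_mod_cast hqn
    have h2 : ((qn : ℚ) : ℝ) < qd := by exact_mod_cast hq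
    push_cast
    exact div_nonneg h1 (by linarith)
  have hq1 : ((qn / qd : ℚ) : ℝ) < 1 := by
    have h1 : (0 : ℝ) ≤ ((qn : ℚ) : ℝ) := by exact_mod_cast hqn
    have h2 : ((qn : ℚ) : ℝ) < qd := by exact_mod_cast hq
    push_cast
    rw [div_lt_one (by linarith)]
    exact h2
  have hS : (∑ i ∈ Finset.range N, a i) = ((hypSum a0 num den N : ℚ) : ℝ) := by
    rw [hypSum_eq_sum]
    exact Finset.sum_congr rfl fun i _ => heq i
  have hT : a N = ((hypTerm a0 num den N : ℚ) : ℝ) := heq N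
  -- |t_N| / (1 - qn/qd) = |t_N| · qd / (qd - qn)
  have hgeo : ∀ x : ℝ, x / (1 - ((qn / qd : ℚ) : ℝ)) = x * qd / (qd - qn) := by
    intro x
    have h2 : ((qn : ℚ) : ℝ) < qd := by exact_mod_cast hq
    have h1 : (0 : ℝ) ≤ ((qn : ℚ) : ℝ) := by exact_mod_cast hqn
    have hne : ((qd : ℚ) : ℝ) - qn ≠ 0 := by linarith
    have hne' : ((qd : ℚ) : ℝ) ≠ 0 := by linarith
    push_cast
    field_simp
  cases m with
  | geom =>
      have h := tsum_bounds_of_abs_succ_le hq0 hq1 hratio (A := |a N|) le_rfl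
      refine ⟨h.1, ?_, ?_⟩
      · have h2 := h.2.1
        rw [hS, hT, hgeo] at h2
        simp only [hypBounds, hypSum, hypTerm] at h2 ⊢
        push_cast
        linarith
      · have h2 := h.2.2
        rw [hS, hT, hgeo] at h2
        simp only [hypBounds, hypSum, hypTerm] at h2 ⊢
        push_cast
        linarith
  | alt =>
      simp only [hypCheck, Bool.and_eq_true] at hc
      have hneg : ∀ n : ℕ, N ≤ n → Poly.eval num n < 0 := fun n hn => by
        have h1 := eval_pos_of_posFrom hc.2 (x := (n : ℝ)) (by exact_mod_cast hn)
        rw [Poly.eval_smul] at h1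
        push_cast at h1
        linarith
      have hs : Summable a := summable_of_abs_succ_le hq1 hratio
      have halt : ∀ n : ℕ, N ≤ n → a n * a (n + 1) ≤ 0 := fun n hn => by
        have hD := (hrat n hn).1
        have h1 : (a n * a (n + 1)) * Poly.eval den n = a n * a n * Poly.eval num n := by
          rw [mul_assoc, hrec n]; ring
        have h2 : a n * a n * Poly.eval num n ≤ 0 :=
          mul_nonpos_of_nonneg_of_nonpos (mul_self_nonneg _) (hneg n hn).le
        rcases le_or_gt (a n * a (n + 1)) 0 with hle | hcon
        · exact hle
        · have : 0 < (a n * a (n + 1)) * Poly.eval den n := mul_pos hcon hD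
          linarith
      have hmono : ∀ n : ℕ, N ≤ n → |a (n + 1)| ≤ |a n| := fun n hn =>
        (hratio n hn).trans (mul_le_of_le_one_left (abs_nonneg _) hq1.le)
      have h := tsum_bounds_of_alternating hs halt hmono
      refine ⟨hs, ?_, ?_⟩
      · have h2 := h.1
        rw [hS, hT] at h2
        simp only [hypBounds, hypSum, hypTerm] at h2 ⊢
        push_cast
        exact h2
      · have h2 := h.2
        rw [hS, hT] at h2
        simp only [hypBounds, hypSum, hypTerm] at h2 ⊢
        push_cast
        exact h2
  | pos =>
      simp only [hypCheck, Bool.and_eq_true, decide_eq_true_eq] at hc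
      obtain ⟨⟨-, hpn⟩, htN⟩ := hc
      have hposnum : ∀ n : ℕ, N ≤ n → 0 < Poly.eval num n := fun n hn =>
        eval_pos_of_posFrom hpn (x := (n : ℝ)) (by exact_mod_cast hn)
      have haN : 0 ≤ a N := by rw [hT]; exact_mod_cast htN
      have hpos : ∀ n : ℕ, N ≤ n → 0 ≤ a n := by
        intro n hn
        induction n, hn using Nat.le_induction with
        | base => exact haN
        | succ k hk ih =>
            have hD := (hrat k hk).1
            have h1 : a (k + 1) = a k * Poly.eval num k / Poly.eval den k := by
              rw [← hrec k, mul_div_cancel_right₀ _ hD.ne']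
            rw [h1]
            exact div_nonneg (mul_nonneg ih (hposnum k hk).le) hD.le
      have h := tsum_bounds_of_abs_succ_le_of_nonneg hq0 hq1 hratio hpos
      refine ⟨h.1, ?_, ?_⟩
      · have h2 := h.2.1
        rw [hS, hT] at h2
        simp only [hypBounds, hypSum, hypTerm] at h2 ⊢
        push_cast
        exact h2
      · have h2 := h.2.2
        rw [hS, hT, hgeo] at h2
        simp only [hypBounds, hypSum, hypTerm] at h2 ⊢
        push_cast
        linarith

end Hypergeometric

namespace OpSem

variable {M : OpModel} (F : OpSem M)

/-- **The assembled enclosure from a box ratio certificate** (any family, uniformly over the parameter box): with an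
index map `g` into the box from `N` on, the majorant identification `|aₙ₊₁|·Den(ps; g n) ≤ |aₙ|·|Num(ps; g n)|`, a
head enclosure `S(N)·S ∈ Hd` and `|a_N| ≤ A`:
`Hd.lo/S − A·qd/(qd − qn) ≤ ∑' n, a n ≤ Hd.hi/S + A·qd/(qd − qn)`.
[cite: Johansson2019, Sect. 4.1 Thm. 1] [cite: MakinoBerz2003, Algorithm 2] -/
theorem tsum_bounds_of_ratioCheck {prm : M.Prm} {S : ℕ} {pN pD : GProg M} {B : PBox} {u0 h : ℚ}
    {csN csD : List (List ℤ × ℕ)} {qn qd : ℚ}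
    (hc : M.ratioCheck prm S pN pD B u0 h csN csD qn qd = true) {ps : List ℝ} (hB : BoxMem ps B)
    {a : ℕ → ℝ} {g : ℕ → ℝ} {N : ℕ} (hg : ∀ n, N ≤ n → |g n - u0| ≤ h)
    (hR : ∀ n, N ≤ n → |a (n + 1)| * F.toFunP pD ps (g n) ≤ |a n| * |F.toFunP pN ps (g n)|)
    {Hd : MI} (hH : MI.mem S (∑ i ∈ Finset.range N, a i) Hd) {A : ℚ} (hA : |a N| ≤ A) :
    Summable a ∧ ((Hd.lo : ℤ) : ℝ) / S - (A : ℝ) * qd / (qd - qn) ≤ ∑' n, a n ∧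
      ∑' n, a n ≤ ((Hd.hi : ℤ) : ℝ) / S + (A : ℝ) * qd / (qd - qn) := by
  have hS : 0 < S := by
    unfold OpModel.ratioCheck at hc
    simp only [Bool.and_eq_true, decide_eq_true_eq] at hc
    exact hc.1.1.1.1.1.1.1
  have hSr : (0 : ℝ) < S := by exact_mod_cast hS
  obtain ⟨hqn, hq, -, -⟩ := F.pos_and_ratio_le_of_ratioCheck hc hB (hg N le_rfl)
  have hqnr : (0 : ℝ) ≤ ((qn : ℚ) : ℝ) := by exact_mod_cast hqn
  have hqr : ((qn : ℚ) : ℝ) < qd := by exact_mod_cast hq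
  have hratio : ∀ n, N ≤ n → |a (n + 1)| ≤ ((qn : ℝ) / qd) * |a n| := by
    intro n hn
    obtain ⟨-, -, hD, hNum⟩ := F.pos_and_ratio_le_of_ratioCheck hc hB (hg n hn)
    have h1 := hR n hn
    have h2 : |a n| * |F.toFunP pN ps (g n)| ≤ |a n| * (((qn : ℝ) / qd) * F.toFunP pD ps (g n)) := by
      refine mul_le_mul_of_nonneg_left ?_ (abs_nonneg _)
      rw [div_mul_eq_mul_div, le_div_iff₀ (by linarith)]
      linarith
    have h3 : |a (n + 1)| * F.toFunP pD ps (g n) ≤ (((qn : ℝ) / qd) * |a n|) * F.toFunP pD ps (g n) := by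
      calc |a (n + 1)| * F.toFunP pD ps (g n) ≤ |a n| * |F.toFunP pN ps (g n)| := h1
        _ ≤ |a n| * (((qn : ℝ) / qd) * F.toFunP pD ps (g n)) := h2
        _ = (((qn : ℝ) / qd) * |a n|) * F.toFunP pD ps (g n) := by ring
    exact le_of_mul_le_mul_right h3 hD
  have hq0 : (0 : ℝ) ≤ (qn : ℝ) / qd := div_nonneg hqnr (by linarith)
  have hq1 : (qn : ℝ) / qd < 1 := by rw [div_lt_one (by linarith)]; exact hqr
  have h := tsum_bounds_of_abs_succ_le hq0 hq1 hratio (A := (A : ℝ)) (by exact_mod_cast hA)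
  have hgeo : (A : ℝ) / (1 - (qn : ℝ) / qd) = (A : ℝ) * qd / (qd - qn) := by
    have hne : (qd : ℝ) - qn ≠ 0 := by linarith
    have hne' : (qd : ℝ) ≠ 0 := by linarith
    field_simp
  rw [hgeo] at h
  obtain ⟨hlo, hhi⟩ := hH
  have hlo' : ((Hd.lo : ℤ) : ℝ) / S ≤ ∑ i ∈ Finset.range N, a i := by
    rw [div_le_iff₀ hSr]; exact hlo
  have hhi' : ∑ i ∈ Finset.range N, a i ≤ ((Hd.hi : ℤ) : ℝ) / S := by
    rw [le_div_iff₀ hSr]; exact hhi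
  exact ⟨h.1, by linarith [h.2.1], by linarith [h.2.2]⟩

/-- **The Leibniz sharpening on a box**: with the EQUATION `aₙ₊₁·Den(ps; g n) = aₙ·Num(ps; g n)` and a negativity
certificate of `Num` on the box, the terms alternate from `N` on and the tail lies between `0` and `a_N`: with
`a_N·S ∈ AN`, `Hd.lo/S + min(AN.lo, 0)/S ≤ ∑' n, a n ≤ Hd.hi/S + max(AN.hi, 0)/S`.
[cite: BreuerZwas1993, Sect. 6.2 (6.9)–(6.10)] [cite: MakinoBerz2003, Algorithm 2] -/
theorem tsum_bounds_of_ratioCheck_alt {prm : M.Prm} {S : ℕ} {pN pD : GProg M} {B : PBox} {u0 h : ℚ}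
    {csN csD csN' : List (List ℤ × ℕ)} {qn qd : ℚ}
    (hc : M.ratioCheck prm S pN pD B u0 h csN csD qn qd = true)
    (hneg : M.negOnCheck prm S pN B u0 h csN' = true) {ps : List ℝ} (hB : BoxMem ps B)
    {a : ℕ → ℝ} {g : ℕ → ℝ} {N : ℕ} (hg : ∀ n, N ≤ n → |g n - u0| ≤ h)
    (hR : ∀ n, N ≤ n → a (n + 1) * F.toFunP pD ps (g n) = a n * F.toFunP pN ps (g n))
    {Hd : MI} (hH : MI.mem S (∑ i ∈ Finset.range N, a i) Hd) {AN : MI} (hAN : MI.mem S (a N) AN) :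
    Summable a ∧ ((Hd.lo : ℤ) : ℝ) / S + ((min AN.lo 0 : ℤ) : ℝ) / S ≤ ∑' n, a n ∧
      ∑' n, a n ≤ ((Hd.hi : ℤ) : ℝ) / S + ((max AN.hi 0 : ℤ) : ℝ) / S := by
  have hS : 0 < S := by
    unfold OpModel.ratioCheck at hc
    simp only [Bool.and_eq_true, decide_eq_true_eq] at hc
    exact hc.1.1.1.1.1.1.1
  have hSr : (0 : ℝ) < S := by exact_mod_cast hS
  have hR' : ∀ n, N ≤ n → |a (n + 1)| * F.toFunP pD ps (g n) ≤ |a n| * |F.toFunP pN ps (g n)| := by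
    intro n hn
    obtain ⟨-, -, hD, -⟩ := F.pos_and_ratio_le_of_ratioCheck hc hB (hg n hn)
    rw [← abs_of_pos hD, ← abs_mul, hR n hn, abs_mul]
  have hA : |a N| ≤ ((max |AN.lo| |AN.hi| : ℤ) : ℚ) := by
    have h1 := abs_mul_le_of_mem hAN
    have h2 : |a N| * S ≤ (((max |AN.lo| |AN.hi| : ℤ) : ℚ) : ℝ) := by push_cast at h1 ⊢; exact h1
    -- |a N| ≤ bound/S ≤ bound is false in general; we only need SOME A: use A := max |lo| |hi| (scaled by S ≥ 1)
    have hS1 : (1 : ℝ) ≤ S := by exact_mod_cast hS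
    have h3 : |a N| ≤ |a N| * S := le_mul_of_one_le_right (abs_nonneg _) hS1
    exact h3.trans h2
  obtain ⟨hs, -, -⟩ := F.tsum_bounds_of_ratioCheck hc hB hg hR' hH hA
  obtain ⟨hqn, hq, -, -⟩ := F.pos_and_ratio_le_of_ratioCheck hc hB (hg N le_rfl)
  have hqnr : (0 : ℝ) ≤ ((qn : ℚ) : ℝ) := by exact_mod_cast hqn
  have hqr : ((qn : ℚ) : ℝ) < qd := by exact_mod_cast hq
  have halt : ∀ n, N ≤ n → a n * a (n + 1) ≤ 0 := by
    intro n hn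
    obtain ⟨-, -, hD, -⟩ := F.pos_and_ratio_le_of_ratioCheck hc hB (hg n hn)
    have hNeg := F.neg_of_negOnCheck hneg hB (hg n hn)
    have h1 : (a n * a (n + 1)) * F.toFunP pD ps (g n) = a n * a n * F.toFunP pN ps (g n) := by
      rw [mul_assoc, hR n hn]; ring
    have h2 : a n * a n * F.toFunP pN ps (g n) ≤ 0 :=
      mul_nonpos_of_nonneg_of_nonpos (mul_self_nonneg _) hNeg.le
    rcases le_or_gt (a n * a (n + 1)) 0 with hle | hcon
    · exact hle
    · have : 0 < (a n * a (n + 1)) * F.toFunP pD ps (g n) := mul_pos hcon hD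
      linarith
  have hmono : ∀ n, N ≤ n → |a (n + 1)| ≤ |a n| := by
    intro n hn
    obtain ⟨-, -, hD, hNum⟩ := F.pos_and_ratio_le_of_ratioCheck hc hB (hg n hn)
    have h1 : |F.toFunP pN ps (g n)| ≤ F.toFunP pD ps (g n) := by
      have hqd : (0 : ℝ) < ((qd : ℚ) : ℝ) := by linarith
      have h2 : ((qd : ℚ) : ℝ) * |F.toFunP pN ps (g n)| ≤ ((qd : ℚ) : ℝ) * F.toFunP pD ps (g n) :=
        hNum.trans (mul_le_mul_of_nonneg_right hqr.le hD.le)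
      exact le_of_mul_le_mul_left h2 hqd
    have h3 : |a (n + 1)| * F.toFunP pD ps (g n) ≤ |a n| * F.toFunP pD ps (g n) :=
      (hR' n hn).trans (mul_le_mul_of_nonneg_left h1 (abs_nonneg _))
    exact le_of_mul_le_mul_right h3 hD
  have h := tsum_bounds_of_alternating hs halt hmono
  obtain ⟨hlo, hhi⟩ := hH
  obtain ⟨hAlo, hAhi⟩ := hAN
  have hlo' : ((Hd.lo : ℤ) : ℝ) / S ≤ ∑ i ∈ Finset.range N, a i := by rw [div_le_iff₀ hSr]; exact hlo
  have hhi' : ∑ i ∈ Finset.range N, a i ≤ ((Hd.hi : ℤ) : ℝ) / S := by rw [le_div_iff₀ hSr]; exact hhi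
  have hmin : ((min AN.lo 0 : ℤ) : ℝ) / S ≤ min (a N) 0 := by
    rw [div_le_iff₀ hSr, Int.cast_min, Int.cast_zero, min_mul_of_nonneg _ _ hSr.le, zero_mul]
    exact min_le_min hAlo le_rfl
  have hmax : max (a N) 0 ≤ ((max AN.hi 0 : ℤ) : ℝ) / S := by
    rw [le_div_iff₀ hSr, Int.cast_max, Int.cast_zero, max_mul_of_nonneg _ _ hSr.le, zero_mul]
    exact max_le_max hAhi le_rfl
  exact ⟨hs, by linarith [h.1], by linarith [h.2]⟩

end OpSem

end PolyMP

end Literature.Analysis.ValidatedNumerics
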